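import Mathlib
import HarnessLib
import Summits.Langlands.Langlands.Theorems.NonParallelVoidTensorSquareParallelStubResidualIrreducibilityForm

/-!
# Stub `stub_residualIrreducibility` of crux `TensorSquareParallel` (stmt-Langlands-17009), helper 2a:
# irreducibility of the tensor product of two `2`-dimensional representations — lines and
# isotropic planes

The representation-theoretic heart of Calegari's tensor-induction line (Calegari 2010, §2, §6),
in a CLASSIFICATION-FREE form.  Let `Λ` be a group, `k` an algebraically closed field with
`2 ≠ 0`, and `V, V' : Λ → GL₂(k)` two representations without common eigenvector (irreducible)
such that

* (non-dihedral) no character `η ≠ 1` of `Λ` satisfies `tr V = η · tr V` pointwise, and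
* (not a twist) `V'` is not conjugate to a twist `χ ⊗ V` of `V` by a character `χ : Λ → kˣ`.

Then the tensor product `V ⊗ V'`, realised on `M₂(k)` by `X ↦ V(λ) X V'(λ)ᵀ`, is irreducible:
the only stable subspaces are `0` and `M₂(k)` (`stub_residualIrreducibility_tensor`, in the sequel
file `…StubResidualIrreducibilityTensor`; this file: generalities, stable LINES
(`stub_residualIrreducibility_line`) and totally isotropic stable planes).

Proof of the criterion (no Dickson): a stable LINE `k X₀` gives, if `det X₀ ≠ 0`, the conjugacy
`V' = (c/det V) ⊗ P V P⁻¹` (`P = X₀ᵀ J⁻¹`, `Aᵀ J A = det A · J`), and if `X₀ = v wᵀ` has rank one,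
a common eigenvector `v` of `V`; a stable HYPERPLANE has a stable orthogonal line for the
determinant pairing `B` of helper 1 (pairs act by similitudes); a stable PLANE `W` is either
totally isotropic — then all its elements are singular, `W = v ⊗ k²` or `k² ⊗ w`, and `v`
(resp. `w`) is a common eigenvector of `V` (resp. `V'`) — or non-degenerate, in which case its
two isotropic lines `k v₁w₁ᵀ`, `k v₂w₂ᵀ` are permuted by `Λ`, the stabiliser `Λ₀` has index
`2`, `V(Λ₀)` is diagonal and `V(Λ ∖ Λ₀)` anti-diagonal in the basis `(v₁, v₂)`, so that
`tr V = η · tr V` for the sign character `η` of `Λ/Λ₀` — excluded.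

## References

* [Calegari2010] F. Calegari, *Even Galois representations and the Fontaine–Mazur conjecture*,
  Invent. Math. 185 (2011) 1–16, §2 and §6 (the tensor induction and its residual image).
* J.-P. Serre, *Linear representations of finite groups*, §7.2–§8.1 (Clifford theory for index
  two), for the dihedral mechanism.
-/

set_option linter.dupNamespace false

noncomputable section

namespace Summit.Langlands.Langlands.Theorems.TensorSquareParallel

open scoped MatrixGroups
open Matrix Module

variable {k : Type*} [Field k] {Λ : Type*} [Group Λ]

/-! ## Generalities on the action `X ↦ A X A'ᵀ` -/

/-- `A X A'ᵀ ≠ 0` for `X ≠ 0` and `A, A'` invertible. [folklore] -/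
theorem conj_ne_zero (A A' : GL (Fin 2) k) {X : Matrix (Fin 2) (Fin 2) k} (hX : X ≠ 0) :
    (A : Matrix (Fin 2) (Fin 2) k) * X * ((A' : GL (Fin 2) k) : Matrix (Fin 2) (Fin 2) k)ᵀ ≠ 0 := by
  intro h
  apply hX
  have e : X = ((A⁻¹ : GL (Fin 2) k) : Matrix (Fin 2) (Fin 2) k) *
      ((A : Matrix (Fin 2) (Fin 2) k) * X * ((A' : GL (Fin 2) k) : Matrix (Fin 2) (Fin 2) k)ᵀ) *
      (((A'⁻¹ : GL (Fin 2) k) : Matrix (Fin 2) (Fin 2) k))ᵀ := by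
    rw [Matrix.coe_units_inv, Matrix.coe_units_inv, ← Matrix.mul_assoc, ← Matrix.mul_assoc,
      Matrix.nonsing_inv_mul _ (Matrix.isUnits_det_units A), Matrix.one_mul, Matrix.mul_assoc,
      ← Matrix.transpose_mul, Matrix.nonsing_inv_mul _ (Matrix.isUnits_det_units A'),
      Matrix.transpose_one, Matrix.mul_one]
  rw [e, h, Matrix.mul_zero, Matrix.zero_mul]

/-- `A v ≠ 0` for `v ≠ 0` and `A` invertible. [folklore] -/
theorem mulVec_ne_zero (A : GL (Fin 2) k) {v : Fin 2 → k} (hv : v ≠ 0) :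
    (A : Matrix (Fin 2) (Fin 2) k) *ᵥ v ≠ 0 := by
  intro h
  apply hv
  have : ((A⁻¹ : GL (Fin 2) k) : Matrix (Fin 2) (Fin 2) k) *ᵥ ((A : Matrix (Fin 2) (Fin 2) k) *ᵥ v) = v := by
    rw [Matrix.mulVec_mulVec, Matrix.coe_units_inv,
      Matrix.nonsing_inv_mul _ (Matrix.isUnits_det_units A), Matrix.one_mulVec]
  rw [← this, h, Matrix.mulVec_zero]

/-- Linear algebra of pure tensors: `a • v wᵀ + b • v w'ᵀ = v (a w + b w')ᵀ`. [folklore] -/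
theorem smul_vecMulVec_add_smul_vecMulVec_left (a b : k) (v w w' : Fin 2 → k) :
    a • vecMulVec v w + b • vecMulVec v w' = vecMulVec v (a • w + b • w') := by
  ext i j; simp [vecMulVec_apply]; ring

/-- Linear algebra of pure tensors: `a • v wᵀ + b • v' wᵀ = (a v + b v') wᵀ`. [folklore] -/
theorem smul_vecMulVec_add_smul_vecMulVec_right (a b : k) (v v' w : Fin 2 → k) :
    a • vecMulVec v w + b • vecMulVec v' w = vecMulVec (a • v + b • v') w := by
  ext i j; simp [vecMulVec_apply]; ring

/-- `(t v) wᵀ = v (t w)ᵀ`. [folklore] -/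
theorem vecMulVec_smul_left (t : k) (v w : Fin 2 → k) :
    vecMulVec (t • v) w = vecMulVec v (t • w) := by
  ext i j; simp [vecMulVec_apply]; ring

/-- A vector lying on two independent lines is zero. [folklore] -/
theorem eq_zero_of_mem_span_of_mem_span {M : Type*} [AddCommGroup M] [Module k M] {X₁ X₂ Z : M}
    (hli : LinearIndependent k ![X₁, X₂]) (h1 : Z ∈ k ∙ X₁) (h2 : Z ∈ k ∙ X₂) : Z = 0 := by
  obtain ⟨a, rfl⟩ := Submodule.mem_span_singleton.mp h1
  obtain ⟨b, hb⟩ := Submodule.mem_span_singleton.mp h2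
  have := (LinearIndependent.pair_iff.mp hli) a (-b) (by rw [← hb, neg_smul, add_neg_cancel])
  rw [this.1, zero_smul]

/-- In a plane, two independent vectors span: every element is a combination. [folklore] -/
theorem exists_eq_add_of_finrank_eq_two {M : Type*} [AddCommGroup M] [Module k M]
    [FiniteDimensional k M] {W : Submodule k M} (hW : finrank k W = 2) {X₁ X₂ : M}
    (h1 : X₁ ∈ W) (h2 : X₂ ∈ W) (hli : LinearIndependent k ![X₁, X₂]) :
    ∀ Y ∈ W, ∃ a b : k, Y = a • X₁ + b • X₂ := by
  have hle : Submodule.span k (Set.range ![X₁, X₂]) ≤ W := by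
    rw [Submodule.span_le]
    rintro _ ⟨i, rfl⟩
    fin_cases i
    · exact h1
    · exact h2
  have heq : Submodule.span k (Set.range ![X₁, X₂]) = W := by
    apply Submodule.eq_of_le_of_finrank_eq hle
    rw [finrank_span_eq_card hli, hW]
    simp
  intro Y hY
  rw [← heq, Matrix.range_cons, Matrix.range_cons, Matrix.range_empty, Set.union_empty,
    Set.union_singleton, Submodule.mem_span_pair] at hY
  obtain ⟨b, a, rfl⟩ := hY
  exact ⟨a, b, by rw [add_comm]⟩

/-- A plane has two independent elements. [folklore] -/
theorem exists_linearIndependent_pair_of_finrank_eq_two {M : Type*} [AddCommGroup M] [Module k M]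
    [FiniteDimensional k M] {W : Submodule k M} (hW : finrank k W = 2) :
    ∃ X₁ X₂ : M, X₁ ∈ W ∧ X₂ ∈ W ∧ LinearIndependent k ![X₁, X₂] := by
  let b := Module.finBasisOfFinrankEq k W hW
  refine ⟨b 0, b 1, (b 0).2, (b 1).2, ?_⟩
  have hli : LinearIndependent k (fun i => ((b i : W) : M)) :=
    b.linearIndependent.map' W.subtype (Submodule.ker_subtype W)
  convert hli using 1
  ext i; fin_cases i <;> rfl

/-- Independence of `X, Y` from `B X X = 0`, `B X Y ≠ 0`. [folklore] -/
theorem linearIndependent_of_pairing {M : Type*} [AddCommGroup M] [Module k M]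
    (B : LinearMap.BilinForm k M) {X Y : M} (hXX : B X X = 0) (hXY : B X Y ≠ 0) :
    LinearIndependent k ![X, Y] := by
  have hX : X ≠ 0 := fun h => hXY (by rw [h, LinearMap.map_zero, LinearMap.zero_apply])
  refine LinearIndependent.pair_iff.mpr fun s t hst => ?_
  by_cases ht : t = 0
  · subst ht
    rw [zero_smul, add_zero] at hst
    exact ⟨(smul_eq_zero.mp hst).resolve_right hX, rfl⟩
  · exfalso
    apply hXY
    have hY : Y = (-(s / t)) • X := by
      have : t • Y = -(s • X) := eq_neg_of_add_eq_zero_right hst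
      calc Y = t⁻¹ • (t • Y) := by rw [smul_smul, inv_mul_cancel₀ ht, one_smul]
        _ = _ := by rw [this, smul_neg, smul_smul, neg_smul, div_eq_inv_mul]
    rw [hY, LinearMap.map_smul, smul_eq_mul, hXX, mul_zero]

/-! ## A stable line -/

section Line

variable (V V' : Λ →* GL (Fin 2) k)

/-- **No stable line.**  If `V` has no common eigenvector and `V'` is not conjugate to a twist
of `V`, then no line `k X₀ ⊆ M₂(k)` is stable under `X ↦ V(λ) X V'(λ)ᵀ`: for `X₀ = v wᵀ` of rank
one, `v` would be a common eigenvector of `V`; for `det X₀ ≠ 0`, transposing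
`V X₀ V'ᵀ = c X₀` and using `Aᵀ J A = det A · J` (`J` the standard symplectic matrix) gives
`V' = (c / det V) · P V P⁻¹` with `P = X₀ᵀ J⁻¹`, and the scalars form a character
(`exists_character_of_forall_exists_smul`). [folklore] -/
theorem not_stable_line
    (hV : ∀ v : Fin 2 → k, v ≠ 0 → ∃ x, ((V x : GL (Fin 2) k) : Matrix (Fin 2) (Fin 2) k) *ᵥ v ∉ k ∙ v)
    (hii : ¬ ∃ (χ : Λ →* kˣ) (P : GL (Fin 2) k), ∀ x,
      ((V' x : GL (Fin 2) k) : Matrix (Fin 2) (Fin 2) k) =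
        (χ x : k) • (((P * V x * P⁻¹ : GL (Fin 2) k)) : Matrix (Fin 2) (Fin 2) k))
    {X₀ : Matrix (Fin 2) (Fin 2) k} (hX₀ : X₀ ≠ 0)
    (hstab : ∀ x, ∃ c : k, ((V x : GL (Fin 2) k) : Matrix (Fin 2) (Fin 2) k) * X₀ *
      ((V' x : GL (Fin 2) k) : Matrix (Fin 2) (Fin 2) k)ᵀ = c • X₀) : False := by
  by_cases hdet : X₀.det = 0
  · -- rank one: `X₀ = v wᵀ`, and `v` is a common eigenvector of `V`
    obtain ⟨v, w, hv, hw, rfl⟩ := exists_eq_vecMulVec_of_det_eq_zero hX₀ hdet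
    obtain ⟨x, hx⟩ := hV v hv
    obtain ⟨c, hc⟩ := hstab x
    rw [mul_vecMulVec_mul_transpose] at hc
    refine hx (mem_span_of_vecMulVec_mem_span (Submodule.mem_span_singleton.mpr ⟨c, hc.symm⟩)
      (mulVec_ne_zero _ hv) (mulVec_ne_zero _ hw)).1
  · -- invertible: `V'` is conjugate to a twist of `V`
    apply hii
    set J : Matrix (Fin 2) (Fin 2) k := !![0, -1; 1, 0] with hJ
    have hJdet : J.det = 1 := by simp [hJ, Matrix.det_fin_two]
    have hPdet : (X₀ᵀ * J).det ≠ 0 := by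
      rw [Matrix.det_mul, Matrix.det_transpose, hJdet, mul_one]; exact hdet
    set P : GL (Fin 2) k := Matrix.GeneralLinearGroup.mkOfDetNeZero _ hPdet with hP
    have hPval : (P : Matrix (Fin 2) (Fin 2) k) = X₀ᵀ * J := rfl
    -- the symplectic identity `Aᵀ J A = det A • J`
    have hsymp : ∀ A : Matrix (Fin 2) (Fin 2) k, Aᵀ * J * A = A.det • J := fun A => by
      ext i j
      fin_cases i <;> fin_cases j <;>
        simp [hJ, Matrix.mul_apply, Fin.sum_univ_two, Matrix.det_fin_two] <;> ring
    suffices h : ∀ x, ∃ c : k, ((V' x : GL (Fin 2) k) : Matrix (Fin 2) (Fin 2) k) =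
        c • (((P * V x * P⁻¹ : GL (Fin 2) k)) : Matrix (Fin 2) (Fin 2) k) by
      obtain ⟨χ, hχ⟩ := exists_character_of_forall_exists_smul V V' P h
      exact ⟨χ, P, hχ⟩
    intro x
    obtain ⟨c, hc⟩ := hstab x
    set A : Matrix (Fin 2) (Fin 2) k := ((V x : GL (Fin 2) k) : Matrix (Fin 2) (Fin 2) k) with hA
    set A' : Matrix (Fin 2) (Fin 2) k := ((V' x : GL (Fin 2) k) : Matrix (Fin 2) (Fin 2) k) with hA'
    have hAdet : A.det ≠ 0 := (Matrix.isUnits_det_units (V x)).ne_zero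
    -- transpose of the stability relation: `A' X₀ᵀ Aᵀ = c X₀ᵀ`
    have hct : A' * X₀ᵀ * Aᵀ = c • X₀ᵀ := by
      have := congrArg Matrix.transpose hc
      rwa [Matrix.transpose_mul, Matrix.transpose_mul, Matrix.transpose_transpose,
        Matrix.transpose_smul, ← Matrix.mul_assoc] at this
    -- `det A • (A' P) = c • (P A)`
    have key : A.det • (A' * (X₀ᵀ * J)) = c • (X₀ᵀ * J * A) := by
      calc A.det • (A' * (X₀ᵀ * J)) = A' * X₀ᵀ * (A.det • J) := by
            rw [Matrix.mul_smul, Matrix.mul_assoc]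
        _ = A' * X₀ᵀ * (Aᵀ * J * A) := by rw [hsymp]
        _ = (A' * X₀ᵀ * Aᵀ) * J * A := by simp only [Matrix.mul_assoc]
        _ = c • (X₀ᵀ * J * A) := by rw [hct, Matrix.smul_mul, Matrix.smul_mul]
    refine ⟨c / A.det, ?_⟩
    -- `A' = (c / det A) • P A P⁻¹`
    have hPinv : (X₀ᵀ * J) * (((P⁻¹ : GL (Fin 2) k)) : Matrix (Fin 2) (Fin 2) k) = 1 := by
      rw [← hPval, ← Units.val_mul, mul_inv_cancel, Units.val_one]
    calc A' = A' * ((X₀ᵀ * J) * (((P⁻¹ : GL (Fin 2) k)) : Matrix (Fin 2) (Fin 2) k)) := by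
          rw [hPinv, Matrix.mul_one]
      _ = (A.det⁻¹ * A.det) • (A' * (X₀ᵀ * J)) * (((P⁻¹ : GL (Fin 2) k)) : Matrix (Fin 2) (Fin 2) k) := by
          rw [inv_mul_cancel₀ hAdet, one_smul]; simp only [Matrix.mul_assoc]
      _ = A.det⁻¹ • (c • (X₀ᵀ * J * A)) * (((P⁻¹ : GL (Fin 2) k)) : Matrix (Fin 2) (Fin 2) k) := by
          rw [← smul_smul, key]
      _ = (c / A.det) • (((P * V x * P⁻¹ : GL (Fin 2) k)) : Matrix (Fin 2) (Fin 2) k) := by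
          rw [smul_smul, div_eq_inv_mul, Units.val_mul, Units.val_mul, hPval, Matrix.smul_mul]

/-- **No stable subspace of dimension one** (reformulation of `not_stable_line`). [folklore] -/
theorem not_stable_of_finrank_eq_one
    (hV : ∀ v : Fin 2 → k, v ≠ 0 → ∃ x, ((V x : GL (Fin 2) k) : Matrix (Fin 2) (Fin 2) k) *ᵥ v ∉ k ∙ v)
    (hii : ¬ ∃ (χ : Λ →* kˣ) (P : GL (Fin 2) k), ∀ x,
      ((V' x : GL (Fin 2) k) : Matrix (Fin 2) (Fin 2) k) =
        (χ x : k) • (((P * V x * P⁻¹ : GL (Fin 2) k)) : Matrix (Fin 2) (Fin 2) k))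
    {W : Submodule k (Matrix (Fin 2) (Fin 2) k)}
    (hW : ∀ x, ∀ X ∈ W, ((V x : GL (Fin 2) k) : Matrix (Fin 2) (Fin 2) k) * X *
      ((V' x : GL (Fin 2) k) : Matrix (Fin 2) (Fin 2) k)ᵀ ∈ W)
    (h1 : finrank k W = 1) : False := by
  obtain ⟨X₀, hX₀, rfl⟩ := exists_eq_span_singleton_of_finrank_eq_one W h1
  refine not_stable_line V V' hV hii hX₀ fun x => ?_
  obtain ⟨c, hc⟩ := Submodule.mem_span_singleton.mp
    (hW x X₀ (Submodule.mem_span_singleton_self X₀))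
  exact ⟨c, hc.symm⟩

end Line

/-! ## Stable planes -/

section Plane

variable (V V' : Λ →* GL (Fin 2) k)

/-- **No stable totally isotropic plane.**  A plane `W ⊆ M₂(k)` all of whose elements are
singular is `v ⊗ k²` or `k² ⊗ w` (two independent rank-one elements `v₁w₁ᵀ`, `v₂w₂ᵀ` with
`det(v₁,v₂) det(w₁,w₂) = B(v₁w₁ᵀ, v₂w₂ᵀ) = 0`); if it is stable, `v` is a common eigenvector of
`V` (resp. `w` of `V'`). [folklore] -/
theorem not_stable_isotropic_plane
    (hV : ∀ v : Fin 2 → k, v ≠ 0 → ∃ x, ((V x : GL (Fin 2) k) : Matrix (Fin 2) (Fin 2) k) *ᵥ v ∉ k ∙ v)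
    (hV' : ∀ v : Fin 2 → k, v ≠ 0 → ∃ x, ((V' x : GL (Fin 2) k) : Matrix (Fin 2) (Fin 2) k) *ᵥ v ∉ k ∙ v)
    (h2 : (2 : k) ≠ 0) {B : LinearMap.BilinForm k (Matrix (Fin 2) (Fin 2) k)}
    (hB : ∀ X Y, B X Y = X 0 0 * Y 1 1 - X 0 1 * Y 1 0 - X 1 0 * Y 0 1 + X 1 1 * Y 0 0)
    {W : Submodule k (Matrix (Fin 2) (Fin 2) k)}
    (hW : ∀ x, ∀ X ∈ W, ((V x : GL (Fin 2) k) : Matrix (Fin 2) (Fin 2) k) * X *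
      ((V' x : GL (Fin 2) k) : Matrix (Fin 2) (Fin 2) k)ᵀ ∈ W)
    (hW2 : finrank k W = 2) (hiso : ∀ X ∈ W, ∀ Y ∈ W, B X Y = 0) : False := by
  obtain ⟨X₁, X₂, h1, h2m, hli⟩ := exists_linearIndependent_pair_of_finrank_eq_two hW2
  have hX₁ : X₁ ≠ 0 := by simpa using hli.ne_zero 0
  have hX₂ : X₂ ≠ 0 := by simpa using hli.ne_zero 1
  have hdet : ∀ X ∈ W, X.det = 0 := fun X hX => by
    have := hiso X hX X hX
    rw [pairing_self hB] at this
    exact (mul_eq_zero.mp this).resolve_left h2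
  have hrepr := exists_eq_add_of_finrank_eq_two hW2 h1 h2m hli
  obtain ⟨v₁, w₁, hv₁, hw₁, rfl⟩ := exists_eq_vecMulVec_of_det_eq_zero hX₁ (hdet _ h1)
  obtain ⟨v₂, w₂, hv₂, hw₂, rfl⟩ := exists_eq_vecMulVec_of_det_eq_zero hX₂ (hdet _ h2m)
  have h12 := hiso _ h1 _ h2m
  rw [pairing_vecMulVec hB] at h12
  rcases mul_eq_zero.mp h12 with hv | hw
  · -- `v₂ ∈ k v₁`: `W = v₁ ⊗ k²` and `v₁` is a common eigenvector of `V`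
    obtain ⟨t, rfl⟩ := Submodule.mem_span_singleton.mp (mem_span_of_det_two_eq_zero hv₁ hv)
    obtain ⟨x, hx⟩ := hV v₁ hv₁
    have hmem := hW x _ h1
    rw [mul_vecMulVec_mul_transpose] at hmem
    obtain ⟨a, b, hab⟩ := hrepr _ hmem
    rw [vecMulVec_smul_left, smul_vecMulVec_add_smul_vecMulVec_left] at hab
    exact hx (mem_span_of_vecMulVec_mem_span
      (Submodule.mem_span_singleton.mpr ⟨1, by rw [one_smul, hab]⟩)
      (mulVec_ne_zero _ hv₁) (mulVec_ne_zero _ hw₁)).1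
  · -- `w₂ ∈ k w₁`: `W = k² ⊗ w₁` and `w₁` is a common eigenvector of `V'`
    obtain ⟨t, rfl⟩ := Submodule.mem_span_singleton.mp (mem_span_of_det_two_eq_zero hw₁ hw)
    obtain ⟨x, hx⟩ := hV' w₁ hw₁
    have hmem := hW x _ h1
    rw [mul_vecMulVec_mul_transpose] at hmem
    obtain ⟨a, b, hab⟩ := hrepr _ hmem
    rw [← vecMulVec_smul_left, smul_vecMulVec_add_smul_vecMulVec_right] at hab
    exact hx (mem_span_of_vecMulVec_mem_span
      (Submodule.mem_span_singleton.mpr ⟨1, by rw [one_smul, hab]⟩)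
      (mulVec_ne_zero _ hv₁) (mulVec_ne_zero _ hw₁)).2

/-- **No stable line for `V ⊗ V'`** (the registered sub-goal this helper file proves; `∀`-form
of `not_stable_line`): if `V` has no common eigenvector and `V'` is not conjugate to a twist
`χ ⊗ V`, no line of `M₂(k)` is stable under `X ↦ V(λ) X V'(λ)ᵀ`. [folklore] -/
theorem stub_residualIrreducibility_line : ∀ (k : Type) [Field k] (Λ : Type) [Group Λ] (V V' : Λ →* GL (Fin 2) k), (∀ v : Fin 2 → k, v ≠ 0 → ∃ x, (V x).val.mulVec v ∉ k ∙ v) → (¬ ∃ (χ : Λ →* kˣ) (P : GL (Fin 2) k), ∀ x, (V' x).val = (χ x : k) • (P * V x * P⁻¹).val) → ∀ X₀ : Matrix (Fin 2) (Fin 2) k, X₀ ≠ 0 → (∀ x, ∃ c : k, (V x).val * X₀ * (V' x).val.transpose = c • X₀) → False :=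
  fun _ _ _ _ V V' hV hii _ hX₀ hstab => not_stable_line V V' hV hii hX₀ hstab

end Plane

end Summit.Langlands.Langlands.Theorems.TensorSquareParallel

end
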